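import Summits.CriticalPhenomena.Ising3DConformalLimit.Theses.HyperoctahedralRP
import Summits.CriticalPhenomena.Ising3DConformalLimit.Theses.IsingEuclidUpgrade
import Summits.CriticalPhenomena.Ising3DConformalLimit.Theses.WeylWindow
import Summits.CriticalPhenomena.Ising3DConformalLimit.Theses.AnomalousForcesInteraction
import Summits.CriticalPhenomena.Ising3DConformalLimit.Theses.LatticeSDPCertificates
import Literature.Probability.LatticeModels.PointwiseScalingLimitScaleCovariant
import Literature.Probability.LatticeModels.CriticalTwoPointDCPLowerHolds
import Literature.Probability.LatticeModels.CriticalUrsellFourSign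
import Literature.Probability.LatticeModels.SourcedDoubleCurrentsSwitching
import Literature.Probability.LatticeModels.IntersectionSecondMoment
import Literature.Probability.LatticeModels.SusceptibilityMeanFieldBound
import HarnessLib
import Summits.CriticalPhenomena.Ising3DConformalLimit.Theorems.IsingEuclidUpgradeR4NonGaussianDefs
import Summits.CriticalPhenomena.Ising3DConformalLimit.Theorems.IsingEuclidUpgradeR4NonGaussianLamperti
import Summits.CriticalPhenomena.Ising3DConformalLimit.Theorems.IsingEuclidUpgradeR4NonGaussianEtaExists
import Summits.CriticalPhenomena.Ising3DConformalLimit.Theorems.IsingEuclidUpgradeR4NonGaussianSecondMomentBox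
import Summits.CriticalPhenomena.Ising3DConformalLimit.Theorems.IsingEuclidUpgradeR4NonGaussianMomentRatioLowerBound

/-!
# Line `free-covariance-delta-dichotomy` for crux `IsingEuclidUpgradeR4NonGaussian`
(item stmt-CriticalPhenomena-0636) — CHECKED SKELETON (crux-plan, round 1)

Idea card: `Cruxes/IsingEuclidUpgradeR4NonGaussian/Ideas/free-covariance-delta-dichotomy.md`;
line card: `Cruxes/IsingEuclidUpgradeR4NonGaussian/Lines/free-covariance-delta-dichotomy.md`.

The crux (every non-degenerate pointwise scaling limit `S` of the critical Ising₃ correlators,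
`HasPointwiseScalingLimit (criticalCorr 3) ρ S`, `ρ > 0` on `(0,1]`, has `U₄ ≢ 0`) is attacked through
LAMPERTI'S LEVER: the crux's own hypothesis makes the spin dimension a NUMBER. A full-filter limit with
`S₂ > 0` forces `ρ` to be regularly varying of some index `-Δ` along `δ → 0⁺` and `S` to be scale
covariant with dimension `Δ` on non-coincident configurations (`stub_lamperti`; 80 % of it is the
tree theorem `HasPointwiseScalingLimit.exists_rpow_scale_mem_Icc`, which also gives `Δ ∈ [1/2,1]`);
the lattice exponent `η` then EXISTS in the logarithmic sense with `η = 2Δ - 1` (`stub_etaExists`),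
so Duminil-Copin–Panis 2025 Thm 1.5 (`dcp_isingEta_le_half_holds`, proved in tree) pins
`Δ ∈ [1/2, 3/4]`. The crux then splits at the marginal exponent (triage r1-3 sharpening of the
card's `Δ = 1/2 ∨ Δ > 1/2` split, which is kept as the alternative composition `of_meanFieldBranch`):

* `Δ ∈ [1/2, 3/4)` — `stub_currentBranch`: the random-current engine of the SIBLING line
  `four-current-coset-robustness` (fat step = four-current intersection, Δ-uniform below `3/4` and
  provable from the free regular variation; thin step = meeting robustness MR, the open heart);
* `Δ = 3/4` — `stub_marginalExclusion`: no Gaussian limit sits at the marginal exponent; stated in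
  its weakest form (normalised, translation-invariant, continuous, scale-covariant `3/4`, index
  `-3/4`) and PROVED below to follow from either existing item stmt-CriticalPhenomena-2601
  (`AnomalousForcesInteraction.GaussianLimitIsFree`, Markov rigidity: Gaussian ⇒ `Δ = 1/2`) or
  stmt-CriticalPhenomena-5507 (`LatticeSDPCertificates.WindowBelowHalf`, `η_eff < 1/2` between scales);
* the glue that feeds those engines their all-configuration hypotheses is the existing item
  stmt-CriticalPhenomena-4739 (`WeylWindow.LimitNormalisation`, provable now: `S ↦ S·𝟙_{NC}` is again a
  limit, translation invariant and continuous on `NonCoincident`) — a REGISTERED OBLIGATION, taken by name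
  as the one hypothesis `hN` of the composition (prove it on item 4739, not here).

`lean check`: sorries ONLY inside the four `stub_*`; the registered composition
`IsingEuclidUpgradeR4NonGaussian_of (hN : WeylWindow.LimitNormalisation)` concludes literally
`Summit.CriticalPhenomena.Ising3DConformalLimit.Theses.HyperoctahedralRP.IsingEuclidUpgradeR4NonGaussian`
(primary route of the payload; the `IsingEuclidUpgrade` copy is the same `Prop`, `crux_iff_isingEuclidUpgrade`)
by applying the sorry-free implication `crux_of_statements : Lamperti → EtaExists → LimitNormalisation →
CurrentBranch → MarginalExclusion → Crux` to the stubs.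

Disproof.lean (cdisprove gen 2, NOT REFUTED) honoured: §A.1 `false_without_nondegeneracy` — `S₂ > 0`
is used at `stub_lamperti` (the scale function) and in both branches; §A.2 `false_without_latticeClause`
— both branch engines are lattice statements about `criticalCorr 3` (currents; Markov property), the
GFF witness of `GeneralisedFreeFamily` is not a limit of `criticalCorr 3` under either; §A.3 — `ρ > 0`
only divides; §B.5 Wick dichotomy — the marginal branch is exactly "Gaussian ⇒ contradiction"; §C —
the current branch ends in `LatticeU4RatioPositive`-type positivity (sibling line); §D — the `d = 3`
input is the power count `3 - 4Δ > 0` below `3/4` and DCP Thm 1.5 at `3/4`; §E.1 not used.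
-/

noncomputable section

namespace Summit.CriticalPhenomena.Ising3DConformalLimit.Cruxes.IsingEuclidUpgradeR4NonGaussian.FreeCovarianceDeltaDichotomy

open Literature.Probability.LatticeModels Filter Set
open scoped Topology

/-! ### §0. Vocabulary (bodies only; no axioms, no sorries) -/

/-- The crux, by name (primary route `HyperoctahedralRP`). -/
abbrev Crux : Prop :=
  Summit.CriticalPhenomena.Ising3DConformalLimit.Theses.HyperoctahedralRP.IsingEuclidUpgradeR4NonGaussian

/-- The two route copies of the shared item are the same proposition. -/
theorem crux_iff_isingEuclidUpgrade :
    Crux ↔ Summit.CriticalPhenomena.Ising3DConformalLimit.Theses.IsingEuclidUpgrade.IsingEuclidUpgradeR4NonGaussian :=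
  Iff.rfl

/-! (§0 vocabulary `HasIndex`, `IsLimitWithIndex`, `ScaleCovariantOn` and the bookkeeping stub
`stub_vocabulary` now live in the LANDED Defs file `Theorems/IsingEuclidUpgradeR4NonGaussianDefs.lean`, p72420.) -/

/-! ### §1. The intermediate statements of the line -/

/-- **Lamperti** (card's `FreeScaleCovariance`): a non-degenerate pointwise scaling limit of
`criticalCorr 3` (`ρ > 0` on `(0,1]`) has a scaling dimension `Δ ∈ [1/2, 1]` such that `ρ` is
regularly varying of index `-Δ` AND `S n (c·x) = c^{-nΔ} S n x` on non-coincident configurations.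
(Window + covariance = tree `exists_rpow_scale_mem_Icc`; the ratio limit from
`latticeApprox (cδ) x = latticeApprox δ (c⁻¹x)` and the two convergences at `x`, `c⁻¹x`.) -/
def Lamperti : Prop :=
  ∀ (ρ : ℝ → ℝ) (S : CorrFamily 3), (∀ δ ∈ Set.Ioc (0:ℝ) 1, 0 < ρ δ) →
    HasPointwiseScalingLimit (criticalCorr 3) ρ S → IsNondegenerateTwoPoint S →
    ∃ Δ : ℝ, 1/2 ≤ Δ ∧ Δ ≤ 1 ∧ HasIndex ρ Δ ∧ ScaleCovariantOn Δ S

/-- **EtaExists**: under the crux hypotheses with index `Δ`, the critical exponent `η` of `ℤ³` EXISTS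
in the logarithmic sense and equals `2Δ - 1`: `log ⟨σ₀σ_y⟩_{β_c} / log ‖y‖ → -2Δ`
(`HasIsingExponentEta 3 (2Δ-1)`, the hypothesis of Duminil-Copin–Panis 2025 Thm 1.5). -/
def EtaExists : Prop :=
  ∀ (ρ : ℝ → ℝ) (S : CorrFamily 3) (Δ : ℝ), IsLimitWithIndex ρ S Δ →
    HasIsingExponentEta 3 (2 * Δ - 1)

/-- **CurrentBranch** (the SIBLING line `four-current-coset-robustness`, run on its natural domain):
a non-degenerate pointwise limit of `criticalCorr 3` whose renormalisation has index `-Δ` with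
`1/2 ≤ Δ < 3/4` has `U₄ ≢ 0`. Engine: fat step (four-current intersection `≥ c`, `(EN)²/EN² ≍
L^{3-4Δ}ℓ(L)²/B(L) ≥ c` by Karamata on the free regular variation) + thin step MR (meeting
robustness under the switching-coset thinning) + `−U₄^{lat} = 2⟨σσ⟩⟨σσ⟩·P₂` ⇒ Disproof §C
`LatticeU4RatioPositive` ⇒ `HasNontrivialU4`. With the covariance clause among the hypotheses this is
LITERALLY the sibling skeleton's kernel-checked `FourCurrentCosetRobustness.hasNontrivialU4_of_exponent_lt`
(modulo its three stubs), plus the unused extras `HasIndex`, `1/2 ≤ Δ`. -/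
def CurrentBranch : Prop :=
  ∀ (ρ : ℝ → ℝ) (S : CorrFamily 3) (Δ : ℝ), IsLimitWithIndex ρ S Δ → ScaleCovariantOn Δ S →
    1/2 ≤ Δ → Δ < 3/4 → HasNontrivialU4 S

/-- **MarginalExclusion** (the marginal branch `Δ = 3/4`, weakest form): a NORMALISED
(`S = 0` off `NonCoincident`), translation-invariant, scale-covariant (`Δ = 3/4`), continuous-on-`NC`
non-degenerate pointwise limit of `criticalCorr 3` whose renormalisation has index `-3/4` has
`U₄ ≢ 0`. Implied by item stmt-2601 `GaussianLimitIsFree` (`marginalExclusion_of_gaussianLimitIsFree`)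
and by item stmt-5507 `WindowBelowHalf` (`marginalExclusion_of_windowBelowHalf`). -/
def MarginalExclusion : Prop :=
  ∀ (ρ : ℝ → ℝ) (S : CorrFamily 3), IsLimitWithIndex ρ S (3/4) →
    (∀ n z, z ∉ NonCoincident 3 n → S n z = 0) → IsTranslationInvariant S →
    IsScaleCovariant (3/4) S → (∀ n, ContinuousOn (S n) (NonCoincident 3 n)) → HasNontrivialU4 S

/-- **MeanFieldBranch** (the card's ORIGINAL `Δ = 1/2` branch; not a registered stub — it is consumed
only by the alternative composition `of_meanFieldBranch`): a non-degenerate pointwise limit whose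
renormalisation has index `-1/2` (`η = 0` in the regular-variation sense) has `U₄ ≢ 0`. In the
expected world (`Δ_σ ≈ 0.518`) this is vacuous; its engine is the current engine at `η = 0` or a proof
of `η_rv > 0` (Disproof §E.2: for OS-positive rotation-invariant limits JSP makes the branch empty). -/
def MeanFieldBranch : Prop :=
  ∀ (ρ : ℝ → ℝ) (S : CorrFamily 3), IsLimitWithIndex ρ S (1/2) → ScaleCovariantOn (1/2) S →
    HasNontrivialU4 S

/-! ### §2. Registered stubs -/

/-! `stub_lamperti`: LANDED (Theorems file, imported above). -/

/-! `stub_etaExists`: LANDED (Theorems file, imported above). -/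


/-! ### §2b. RESHAPE (line lead, 2026-08-16): `stub_currentBranch` replaced by the SIBLING line's three
registered stubs (`four-current-coset-robustness`, whose kernel-checked `hasNontrivialU4_of_exponent_lt` IS
`CurrentBranch` modulo its stubs). Objects, stubs and glue below are copied VERBATIM from
`Cruxes/IsingEuclidUpgradeR4NonGaussian/Lines/four-current-coset-robustness.lean`; `ScaleCovariantOn` is
the definition of §0 above (identical text). Total registered stubs of this skeleton: 5
(`stub_lamperti`, `stub_etaExists`, `stub_secondMomentBox`, `stub_momentRatioLowerBound`,
`stub_meetingRobustness`, `stub_marginalExclusion` = 6 with the marginal branch). -/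

section CurrentBranchReshaped

open Function MeasureTheory Finset Literature.Probability.Percolation
open scoped symmDiff

/-! ## Objects: see the landed Defs file (`lat`, `boxG`, `twoCurrentMeet`, `fourCurrentLaw`, `FourMeet`,
`fourCurrentMeet`, `threePointRatio`, `boxMoment₁`, `twoStep`, `boxMoment₂`, `latU4`). -/

/-- **The Disproof's ρ-free LATTICE TARGET (§C, VERBATIM)**: at some non-coincident quadruple `x` and
some `c > 0`, `-U₄^{lat}([x/δ]) ≥ c·⟨σ_{[x₀/δ]}σ_{[x₁/δ]}⟩⟨σ_{[x₂/δ]}σ_{[x₃/δ]}⟩` for all small `δ > 0`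
— "the double-current intersection probability at scale `1/δ` stays bounded below" (ADC21 (3.11)).
`Iff.rfl` with `Disproof.LatticeU4RatioPositive`. [cite: AizenmanDuminilCopinAnnals2021, eq. (3.11)] -/
def LatticeU4RatioPositive : Prop :=
  ∃ x ∈ NonCoincident 3 4, ∃ c : ℝ, 0 < c ∧ ∀ᶠ δ in 𝓝[>] (0:ℝ),
    c * (criticalCorr 3 2 ![latticeApprox δ (x 0), latticeApprox δ (x 1)] *
      criticalCorr 3 2 ![latticeApprox δ (x 2), latticeApprox δ (x 3)]) ≤ - latU4 δ x

/-! ## The registered stubs -/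

/-! `stub_secondMomentBox`: LANDED (Theorems file, imported above). -/

/-! `stub_momentRatioLowerBound`: LANDED (Theorems file, imported above). -/

/-- **STUB 3 — THIN STEP = MEETING ROBUSTNESS `MR` (the card's Transfer `C⁺`; OPEN, size XL — the
HARDEST stub, the open heart of the line). LEAD'S CALIBRATION (2026-08-16, kernel-checked in
`Theorems/IsingEuclidUpgradeR4NonGaussianFatStep.lean`, `meetingRobustness_iff_hasNontrivialU4`): with the
fat step now a THEOREM (`stub_fatStep` = `stub_secondMomentBox` ∘ `stub_momentRatioLowerBound`, both landed),
the conclusion below for a given `(ρ,S,Δ<3/4)` is EQUIVALENT to `HasNontrivialU4 S` — the stub is the crux's own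
conclusion in random-current clothing (promote-stub).** Under the crux hypotheses with `Δ < 3/4` there is ONE
non-coincident quadruple `x` and `c > 0` with `P² ≥ c · P⁴` at `x̃ = [x/δ]` for all small `δ` and large
`L`: conditionally on the two FAT clusters `C_{n₁+n₃}(x̃₀)`, `C_{n₂+n₄}(x̃₂)` being glued, the THIN
pair still joins `x̃₀` to `x̃₂` in `n₁ + n₂` with probability `≥ c` (`P²` is the `P⁴`-probability of
`{x̃₀ ↔ x̃₂ in n₁+n₂}`: the `(n₁,n₂)`-marginal of `P^{ab,∅} ⊗ P^{ce,∅}` is `P^{ab} ⊗ P^{ce}` =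
`doubleCurrentMeasure _ _ {a,b} {c,e}`, read on the trace by `sourcedTrace_preimage_openConn`).
WHY EASIER than the crux (card + triage): (i) the conditional law is EXPLICIT — given `m = n₁+n₃`,
`n₁` is a uniform element of the parity coset `{n ≤ m̃ : ∂n = {x̃₀,x̃₁}}` of the edge-copy multigraph
(independent fair coins on the copies conditioned on the boundary: the combinatorial core of the
switching lemma, `w(n₁)w(n₃) = w(m)∏ C(m_e, n₁,e)`), independently for `(n₂ | n₂+n₄)`, and by
switching `P^{ab,∅}[· | v ∈ C_{n₁+n₃}(a)]` is the law of the sum of two independent sourced currents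
`a → v`, `v → b`; so near a contact site the question is finite `𝔽₂`-linear algebra on the local cycle
space; (ii) pairing involutions give free partial robustness (`P_coins[deg_{n₁}(v) ≥ 2 | m] ≥ 1/2`; a
cut vertex of the multigraph between the `a`- and `b`-sides lies on `C_{n₁}(a)` surely); (iii) two
sufficient conditions of different flavour: `RobustCoreDensity` (≈ the single ≥ c·double one-point
comparison — probably FALSE as an `O(1)` statement by the card's own `d = 1`/Lupu–Werner toy and
`D_HT ≈ 1.73 < 2 − η`, triage r1-1/3: do NOT start there) and the coin-free `BackboneContact`
`P^{ab} ⊗ P^{ce}[backbone(n₁) ∩ backbone(n₂) ≠ ∅] ≥ c` (a common vertex of the two backbones gives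
`a ↔ c in n₁+n₂` outright; second-moment problem for Aizenman's backbone with the chain rule — tree
`BackboneChainRule`, `BackboneKernel`, upper bounds proved — whose missing input is a one-point LOWER
bound through the depleted two-point function; triage r1-2: "the coin-free sufficient condition to
stub first", file it with `--supports`). CALIBRATION (why it might fail): given STUBS 1–2, MR is
EQUIVALENT to the crux below `Δ = 3/4` (Disproof §C), and it must FAIL in any Wick world with
`η < 1/2` (the fat step uses no interaction) — the Ising interaction (`σ² = 1` ⇒ hard-core parity
constraint) enters ONLY through the coset; at `Δ = 1/2` exactly, MR is vacuous-or-false (an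
OS-positive rotation-invariant `η = 0` limit would be free by Jost–Schroer–Pohlmeyer, Disproof §E.2),
so its content lives at `Δ ∈ (1/2, 3/4)` ∋ `Δ_σ ≈ 0.518`, where item 2601 is an ALTERNATIVE engine
(Markov inheritance) that this line does not use; numerically `p = −U₄/(2S₂S₂) = O(1)` at
macroscopic separation (Disproof §F), i.e. MR holds with `c ≈ p`. The shared open heart of cards 2/4/6
is a lower bound on the meeting of two independent SINGLE sourced critical currents on `ℤ³` (triage
r1-2 cross-card note).
[cite: AizenmanDuminilCopinAnnals2021, Lemma 3.3 (switching) and eq. (3.11)]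
[cite: Aizenman1982, §3 Lemma 3.2 and §5] [cite: LupuWerner2016, Thm. 1 (arXiv:1511.05524)] -/
theorem stub_meetingRobustness :
    ∀ (ρ : ℝ → ℝ) (S : CorrFamily 3) (Δ : ℝ), (∀ δ ∈ Set.Ioc (0:ℝ) 1, 0 < ρ δ) →
      HasPointwiseScalingLimit (criticalCorr 3) ρ S → IsNondegenerateTwoPoint S →
      ScaleCovariantOn Δ S → Δ < 3 / 4 →
      ∃ x ∈ NonCoincident 3 4, ∃ c : ℝ, 0 < c ∧
        ∀ᶠ δ in 𝓝[>] (0:ℝ), ∀ᶠ L : ℕ in atTop,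
          c * fourCurrentMeet L (lat δ x 0) (lat δ x 1) (lat δ x 2) (lat δ x 3) ≤
            twoCurrentMeet L (lat δ x 0) (lat δ x 1) (lat δ x 2) (lat δ x 3) := by
  sorry


/-! ## Proved glue -/

/-- Eventually (in `L`) the four lattice points and a given finite set lie in the box `Λ_L`. [folklore] -/
theorem eventually_mem_box (δ : ℝ) (x : Fin 4 → EuclideanSpace ℝ (Fin 3)) (A : Finset (Site 3)) :
    ∀ᶠ L : ℕ in atTop, (∀ i, lat δ x i ∈ box 3 L) ∧ A ⊆ box 3 L := by
  classical
  obtain ⟨L₀, hL₀⟩ := exists_forall_subset_box 3 (A ∪ Finset.univ.image (lat δ x))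
  filter_upwards [eventually_ge_atTop L₀] with L hL
  refine ⟨fun i => hL₀ L hL ?_, fun v hv => hL₀ L hL (Finset.mem_union_left _ hv)⟩
  exact Finset.mem_union_right _ (Finset.mem_image_of_mem _ (Finset.mem_univ i))

/-- **FAT STEP (STUBS 1 + 2)**: below `Δ = 3/4` the four-current gluing probability at scale `1/δ`
is bounded below, for small `δ` and large `L`, at every non-coincident quadruple.
[cite: AizenmanDuminilCopinAnnals2021, §4.2 Lemma 4.4] -/
theorem fourCurrentMeet_lower {ρ : ℝ → ℝ} {S : CorrFamily 3} {Δ : ℝ}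
    (hρ : ∀ δ ∈ Set.Ioc (0:ℝ) 1, 0 < ρ δ) (hlim : HasPointwiseScalingLimit (criticalCorr 3) ρ S)
    (hnd : IsNondegenerateTwoPoint S) (hcov : ScaleCovariantOn Δ S) (hΔ : Δ < 3 / 4)
    {x : Fin 4 → EuclideanSpace ℝ (Fin 3)} (hx : x ∈ NonCoincident 3 4) :
    ∃ c : ℝ, 0 < c ∧ ∀ᶠ δ in 𝓝[>] (0:ℝ), ∀ᶠ L : ℕ in atTop,
      c ≤ fourCurrentMeet L (lat δ x 0) (lat δ x 1) (lat δ x 2) (lat δ x 3) := by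
  obtain ⟨c, hc, A, hev⟩ := stub_momentRatioLowerBound ρ S Δ hρ hlim hnd hcov hΔ x hx
  refine ⟨c, hc, ?_⟩
  filter_upwards [hev] with δ hδ
  filter_upwards [hδ, eventually_mem_box δ x (A δ)] with L hL hbox
  exact hL.trans (stub_secondMomentBox L _ _ _ _ (hbox.1 0) (hbox.1 1) (hbox.1 2) (hbox.1 3)
    (A δ) hbox.2)

/-- **FAT × THIN (STUBS 1–3)**: below `Δ = 3/4` the double-current gluing probability
`P^{x̃₀x̃₁,x̃₂x̃₃}_{Λ_L}[x̃₀ ↔ x̃₂]` is bounded below at one non-coincident quadruple, for small `δ` and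
large `L`. [cite: AizenmanDuminilCopinAnnals2021, eq. (3.11)] -/
theorem twoCurrentMeet_lower {ρ : ℝ → ℝ} {S : CorrFamily 3} {Δ : ℝ}
    (hρ : ∀ δ ∈ Set.Ioc (0:ℝ) 1, 0 < ρ δ) (hlim : HasPointwiseScalingLimit (criticalCorr 3) ρ S)
    (hnd : IsNondegenerateTwoPoint S) (hcov : ScaleCovariantOn Δ S) (hΔ : Δ < 3 / 4) :
    ∃ x ∈ NonCoincident 3 4, ∃ κ : ℝ, 0 < κ ∧ ∀ᶠ δ in 𝓝[>] (0:ℝ), ∀ᶠ L : ℕ in atTop,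
      κ ≤ twoCurrentMeet L (lat δ x 0) (lat δ x 1) (lat δ x 2) (lat δ x 3) := by
  obtain ⟨x, hx, c, hc, hev⟩ := stub_meetingRobustness ρ S Δ hρ hlim hnd hcov hΔ
  obtain ⟨c', hc', hev'⟩ := fourCurrentMeet_lower hρ hlim hnd hcov hΔ hx
  refine ⟨x, hx, c * c', mul_pos hc hc', ?_⟩
  filter_upwards [hev, hev'] with δ hδ hδ'
  filter_upwards [hδ, hδ'] with L hL hL'
  calc c * c' ≤ c * fourCurrentMeet L (lat δ x 0) (lat δ x 1) (lat δ x 2) (lat δ x 3) :=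
        mul_le_mul_of_nonneg_left hL' hc.le
    _ ≤ _ := hL

/-- **From the box lower bound to the Disproof's ρ-free LATTICE TARGET** (`Λ_L ↑ ℤ³` after `δ`):
if `P^{x̃₀x̃₁,x̃₂x̃₃}_{Λ_L}[x̃₀ ↔ x̃₂] ≥ κ > 0` for small `δ` and large `L`, then
`−U₄^{lat}([x/δ]) ≥ 2κ ⟨σσ⟩⟨σσ⟩([x/δ])` for small `δ` — the box identity `U₄,Λ_L = −2G_LG_L·P²`
(`connectedFour_free_box_eq`), Griffiths I for `G_L ≥ 0`, and the box limits
`tendsto_connectedFour_box_criticalBeta` / `criticalCorr_wellDefined_holds`.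
[cite: AizenmanDuminilCopinAnnals2021, eq. (3.11)–(3.12)] -/
theorem latticeU4RatioPositive_of_twoCurrentMeet_lower
    (h : ∃ x ∈ NonCoincident 3 4, ∃ κ : ℝ, 0 < κ ∧ ∀ᶠ δ in 𝓝[>] (0:ℝ), ∀ᶠ L : ℕ in atTop,
      κ ≤ twoCurrentMeet L (lat δ x 0) (lat δ x 1) (lat δ x 2) (lat δ x 3)) :
    LatticeU4RatioPositive := by
  classical
  obtain ⟨x, hx, κ, hκ, hev⟩ := h
  refine ⟨x, hx, 2 * κ, by positivity, ?_⟩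
  filter_upwards [hev] with δ hδ
  -- the lattice configuration at mesh `δ`
  set y : Fin 4 → Site 3 := fun i => latticeApprox δ (x i) with hy
  have hmem : (BoundaryCondition.free : BoundaryCondition (Site 3)) ∈
      ({.free, .plus, .minus} : Set (BoundaryCondition (Site 3))) := by simp
  -- box two-point functions converge to the critical ones
  have hT : ∀ i j : Fin 4, Tendsto (fun L : ℕ => boxG L (y i) (y j)) atTop
      (𝓝 (criticalCorr 3 2 ![y i, y j])) := by
    intro i j
    have h := criticalCorr_wellDefined_holds (d := 3) (by norm_num) 2 ![y i, y j] .free hmem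
    refine Tendsto.congr (fun L => ?_) h
    simp only [boxG, isingTwoPoint, spinMonomial_two]
  -- the box connected four-point function converges to `latU4 δ x`
  have hU : Tendsto (fun L : ℕ => connectedFour (isingMeasure (zdGraph 3) (box 3 L) (criticalBeta 3)
      0 .free) spinAt y) atTop (𝓝 (latU4 δ x)) :=
    tendsto_connectedFour_box_criticalBeta (d := 3) (by norm_num) y
  have hB := ((hT 0 1).mul (hT 2 3)).const_mul (2 * κ)
  -- the inequality in every large box
  have hle : ∀ᶠ L : ℕ in atTop, 2 * κ * (boxG L (y 0) (y 1) * boxG L (y 2) (y 3)) ≤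
      -(connectedFour (isingMeasure (zdGraph 3) (box 3 L) (criticalBeta 3) 0 .free) spinAt y) := by
    filter_upwards [hδ, eventually_mem_box δ x ∅] with L hL hbox
    have hb := hbox.1
    have hy4 : y = ![y 0, y 1, y 2, y 3] := by funext i; fin_cases i <;> rfl
    have hid := connectedFour_free_box_eq 3 L (criticalBeta_nonneg 3) (hb 0) (hb 1) (hb 2) (hb 3)
    rw [hy4, hid]
    simp only [Matrix.cons_val_zero, Matrix.cons_val_one, Matrix.cons_val]
    have hG01 : 0 ≤ boxG L (y 0) (y 1) := isingTwoPoint_free_nonneg' (criticalBeta_nonneg 3) (hb 0) (hb 1)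
    have hG23 : 0 ≤ boxG L (y 2) (y 3) := isingTwoPoint_free_nonneg' (criticalBeta_nonneg 3) (hb 2) (hb 3)
    have hP : κ ≤ twoCurrentMeet L (y 0) (y 1) (y 2) (y 3) := hL
    have hGG : 0 ≤ boxG L (y 0) (y 1) * boxG L (y 2) (y 3) := mul_nonneg hG01 hG23
    have key := mul_le_mul_of_nonneg_left hP hGG
    unfold twoCurrentMeet at key
    unfold boxG at key hGG ⊢
    nlinarith [key, hGG]
  have hfin := le_of_tendsto_of_tendsto hB hU.neg hle
  -- rewrite the limit inequality in the Disproof's spelling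
  have e01 : (![y 0, y 1] : Fin 2 → Site 3) = ![latticeApprox δ (x 0), latticeApprox δ (x 1)] := rfl
  have e23 : (![y 2, y 3] : Fin 2 → Site 3) = ![latticeApprox δ (x 2), latticeApprox δ (x 3)] := rfl
  rw [e01, e23] at hfin
  exact hfin


/-- **The lattice target suffices (the Disproof's §C.1 `of_latticeU4RatioPositive`, proof copied
verbatim, sorry-free; stated per limit `S` rather than as the named crux so that the skeleton theorem
below is the ONLY theorem concluding the crux decl by name)**: for ANY non-degenerate pointwise limit
`S`, the rescaled lattice inequality passes to the limit (`tendsto_rescaled_criticalUrsellFour`) and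
gives `U₄^S(x) ≤ −c S₂(x₀,x₁)S₂(x₂,x₃) < 0`. [cite: AizenmanDuminilCopinAnnals2021, eq. (3.11)] -/
theorem hasNontrivialU4_of_latticeU4RatioPositive (h : LatticeU4RatioPositive) {ρ : ℝ → ℝ}
    {S : CorrFamily 3} (hlim : HasPointwiseScalingLimit (criticalCorr 3) ρ S)
    (hnd : IsNondegenerateTwoPoint S) : HasNontrivialU4 S := by
  obtain ⟨x, hx, c, hc, hev⟩ := h
  have hinj : Function.Injective x := hx
  have hpair : ∀ i j, i ≠ j → Tendsto
      (fun δ => ρ δ ^ 2 * criticalCorr 3 2 ![latticeApprox δ (x i), latticeApprox δ (x j)])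
      (𝓝[>] 0) (𝓝 (S 2 ![x i, x j])) := by
    intro i j hij
    have hmem : (![x i, x j] : Fin 2 → EuclideanSpace ℝ (Fin 3)) ∈ NonCoincident 3 2 :=
      pair_mem_nonCoincident fun h => hij (hinj h)
    refine Tendsto.congr (fun δ => ?_) ((hlim 2).tendsto_at hmem)
    rw [rescaledCorrelator_apply, latticeApprox_comp_two]
    rfl
  have hU : Tendsto (fun δ => ρ δ ^ 4 * latU4 δ x) (𝓝[>] 0) (𝓝 (limitConnectedFour S x)) :=
    tendsto_rescaled_criticalUrsellFour hlim hx
  have hB := (((hpair 0 1 (by decide)).mul (hpair 2 3 (by decide))).const_mul c)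
  have hle : c * (S 2 ![x 0, x 1] * S 2 ![x 2, x 3]) ≤ - limitConnectedFour S x := by
    refine le_of_tendsto_of_tendsto hB hU.neg ?_
    filter_upwards [hev] with δ hδ
    have h4 : (0:ℝ) ≤ ρ δ ^ 4 := by positivity
    have := mul_le_mul_of_nonneg_left hδ h4
    calc c * (ρ δ ^ 2 * criticalCorr 3 2 ![latticeApprox δ (x 0), latticeApprox δ (x 1)] *
          (ρ δ ^ 2 * criticalCorr 3 2 ![latticeApprox δ (x 2), latticeApprox δ (x 3)]))
        = ρ δ ^ 4 * (c * (criticalCorr 3 2 ![latticeApprox δ (x 0), latticeApprox δ (x 1)] *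
          criticalCorr 3 2 ![latticeApprox δ (x 2), latticeApprox δ (x 3)])) := by ring
      _ ≤ ρ δ ^ 4 * (- latU4 δ x) := this
      _ = -(ρ δ ^ 4 * latU4 δ x) := by ring
  have h01 : (![x 0, x 1] : Fin 2 → _) ∈ NonCoincident 3 2 :=
    pair_mem_nonCoincident fun h => absurd (hinj h) (by decide)
  have h23 : (![x 2, x 3] : Fin 2 → _) ∈ NonCoincident 3 2 :=
    pair_mem_nonCoincident fun h => absurd (hinj h) (by decide)
  have hpos : 0 < c * (S 2 ![x 0, x 1] * S 2 ![x 2, x 3]) :=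
    mul_pos hc (mul_pos (hnd _ h01) (hnd _ h23))
  exact ⟨x, hx, by linarith⟩


/-- **MEAN-FIELD CALIBRATION (kernel-checked, items-free modulo STUBS 1–3)**: a non-degenerate limit
whose exponent is `< 3/4` — in particular any limit with `Δ = 1/2` (`η = 0`) — has `U₄ ≢ 0`. This is
the card's "MeanFieldBranch = four-current at `η = 0`" (triage r1-1 dependency note) and shows where
item 2601 is and is not consumed. [cite: AizenmanDuminilCopinAnnals2021, Lemma 4.4] -/
theorem hasNontrivialU4_of_exponent_lt {ρ : ℝ → ℝ} {S : CorrFamily 3} {Δ : ℝ}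
    (hρ : ∀ δ ∈ Set.Ioc (0:ℝ) 1, 0 < ρ δ) (hlim : HasPointwiseScalingLimit (criticalCorr 3) ρ S)
    (hnd : IsNondegenerateTwoPoint S) (hcov : ScaleCovariantOn Δ S) (hΔ : Δ < 3 / 4) :
    HasNontrivialU4 S :=
  hasNontrivialU4_of_latticeU4RatioPositive
    (latticeU4RatioPositive_of_twoCurrentMeet_lower (twoCurrentMeet_lower hρ hlim hnd hcov hΔ)) hlim hnd


/-- **`CurrentBranch` from the sibling's three stubs** (the reshaped `stub_currentBranch`; the extra
hypotheses `HasIndex`, `1/2 ≤ Δ` are unused gifts). [cite: AizenmanDuminilCopinAnnals2021, Lemma 4.4] -/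
theorem currentBranch_of_stubs : CurrentBranch :=
  fun _ _ _ hWI hcov _ hlt => hasNontrivialU4_of_exponent_lt hWI.1 hWI.2.1 hWI.2.2.1 hcov hlt

end CurrentBranchReshaped


/-- **stub_marginalExclusion** — the marginal branch. Two independent sufficient items, both reductions
kernel-checked below: (a) stmt-2601 `GaussianLimitIsFree` (Newman: `U₄ ≡ 0` ⇒ Gaussian, tree
`CriticalWickDichotomy`; Markov inheritance; Pitt–Kotani–Rozanov: a germ-Markov self-similar Gaussian
field has spectral density `1/P`, `P` a form of degree `3 - 2Δ` ⇒ `Δ = 1/2 ≠ 3/4`);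
(b) stmt-5507 `WindowBelowHalf` (`⟨σ₀σ_{ne₁}⟩ ≥ c (n/m)^{-(3/2-ε)} ⟨σ₀σ_{me₁}⟩`: incompatible with index
`-3/4`, which forces `⟨σ₀σ_{kme₁}⟩/⟨σ₀σ_{me₁}⟩ → k^{-3/2}`). At `Δ = 3/4` exactly no current-based
engine can work (the `d = 3` count degenerates to the `d = 4` marginal one: `(EN)²/EN² ≍ ℓ(L)²/B(L) → 0`,
barrier `IsingTrivialityFromDimensionFour` RESPECTED), which is why this branch is isolated.
[size XL via (a) / open-problem via (b)] -/
theorem stub_marginalExclusion :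
    ∀ (ρ : ℝ → ℝ) (S : CorrFamily 3), IsLimitWithIndex ρ S (3/4) →
      (∀ n z, z ∉ NonCoincident 3 n → S n z = 0) → IsTranslationInvariant S →
      IsScaleCovariant (3/4) S → (∀ n, ContinuousOn (S n) (NonCoincident 3 n)) → HasNontrivialU4 S := by
  sorry

/-! ### §3. Glue lemmas (sorry-free) -/

/-- Two pointwise limits of the same lattice family with the same `ρ` agree on `NonCoincident`
(uniqueness of limits along the non-trivial filter `𝓝[>] 0`). -/
theorem eqOn_of_limits {ρ : ℝ → ℝ} {S S' : CorrFamily 3}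
    (hlim : HasPointwiseScalingLimit (criticalCorr 3) ρ S)
    (hlim' : HasPointwiseScalingLimit (criticalCorr 3) ρ S') (n : ℕ) :
    (NonCoincident 3 n).EqOn (S' n) (S n) :=
  (hlim' n).unique (hlim n)

/-- Pairs extracted from a non-coincident quadruple are non-coincident. -/
theorem pair_mem_of_mem_four {x : Fin 4 → EuclideanSpace ℝ (Fin 3)} (hx : x ∈ NonCoincident 3 4)
    {i j : Fin 4} (hij : i ≠ j) : (![x i, x j] : Fin 2 → EuclideanSpace ℝ (Fin 3)) ∈ NonCoincident 3 2 := by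
  have hinj : Function.Injective x := hx
  exact pair_mem_nonCoincident fun h => hij (hinj h)

/-- `U₄` only reads `S` on non-coincident configurations. -/
theorem limitConnectedFour_congr {S S' : CorrFamily 3}
    (h2 : (NonCoincident 3 2).EqOn (S' 2) (S 2)) (h4 : (NonCoincident 3 4).EqOn (S' 4) (S 4))
    {x : Fin 4 → EuclideanSpace ℝ (Fin 3)} (hx : x ∈ NonCoincident 3 4) :
    limitConnectedFour S' x = limitConnectedFour S x := by
  simp only [limitConnectedFour]
  rw [h4 hx, h2 (pair_mem_of_mem_four hx (i := 0) (j := 1) (by decide)),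
    h2 (pair_mem_of_mem_four hx (i := 2) (j := 3) (by decide)),
    h2 (pair_mem_of_mem_four hx (i := 0) (j := 2) (by decide)),
    h2 (pair_mem_of_mem_four hx (i := 1) (j := 3) (by decide)),
    h2 (pair_mem_of_mem_four hx (i := 0) (j := 3) (by decide)),
    h2 (pair_mem_of_mem_four hx (i := 1) (j := 2) (by decide))]

/-- `HasNontrivialU4` is decided on non-coincident configurations. -/
theorem hasNontrivialU4_iff_of_eqOn {S S' : CorrFamily 3}
    (h : ∀ n, (NonCoincident 3 n).EqOn (S' n) (S n)) : HasNontrivialU4 S' ↔ HasNontrivialU4 S := by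
  constructor
  · rintro ⟨x, hx, hne⟩
    exact ⟨x, hx, by rwa [limitConnectedFour_congr (h 2) (h 4) hx] at hne⟩
  · rintro ⟨x, hx, hne⟩
    exact ⟨x, hx, by rwa [← limitConnectedFour_congr (h 2) (h 4) hx] at hne⟩

/-- Scale covariance on `NonCoincident` of `S` becomes full `IsScaleCovariant` of its normalisation. -/
theorem isScaleCovariant_of_normalised {S S' : CorrFamily 3} {Δ : ℝ}
    (heqOn : ∀ n, (NonCoincident 3 n).EqOn (S' n) (S n))
    (hzero : ∀ n z, z ∉ NonCoincident 3 n → S' n z = 0)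
    (hcov : ScaleCovariantOn Δ S) :
    IsScaleCovariant Δ S' := by
  intro n c hc z
  by_cases hz : Function.Injective z
  · have hzm : z ∈ NonCoincident 3 n := hz
    have hz' : (fun i => c • z i) ∈ NonCoincident 3 n := smul_mem_nonCoincident hc.ne' hzm
    rw [heqOn n hz', heqOn n hzm]
    exact hcov n c hc z hzm
  · have hz' : (fun i => c • z i) ∉ NonCoincident 3 n := fun h =>
      hz ((smul_right_injective (EuclideanSpace ℝ (Fin 3)) hc.ne').of_comp_iff z |>.1 h)
    rw [hzero n _ hz', hzero n z hz, mul_zero]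

/-- The normalisation package of item 4739, with the clauses this line consumes made explicit:
`S'` agrees with `S` on `NonCoincident`, inherits the index, and is fully scale covariant. -/
theorem normalise (hN : Summit.CriticalPhenomena.Ising3DConformalLimit.Theses.WeylWindow.LimitNormalisation)
    {ρ : ℝ → ℝ} {S : CorrFamily 3} {Δ : ℝ} (h : IsLimitWithIndex ρ S Δ) (hcov : ScaleCovariantOn Δ S) :
    ∃ S' : CorrFamily 3, IsLimitWithIndex ρ S' Δ ∧ (∀ n, (NonCoincident 3 n).EqOn (S' n) (S n)) ∧
      (∀ n z, z ∉ NonCoincident 3 n → S' n z = 0) ∧ IsTranslationInvariant S' ∧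
      IsScaleCovariant Δ S' ∧ (∀ n, ContinuousOn (S' n) (NonCoincident 3 n)) := by
  obtain ⟨hρ, hlim, hnd, hidx⟩ := h
  obtain ⟨S', hlim', hzero, hnd', hTI, hcont⟩ := hN ρ S hρ hlim hnd
  have heqOn : ∀ n, (NonCoincident 3 n).EqOn (S' n) (S n) := eqOn_of_limits hlim hlim'
  exact ⟨S', ⟨hρ, hlim', hnd', hidx⟩, heqOn, hzero, hTI,
    isScaleCovariant_of_normalised heqOn hzero hcov, hcont⟩

/-! ### §4. The kernel-checked composition -/

/-- **The line's implication** (sorry-free): Lamperti fixes `Δ ∈ [1/2,1]` and the index; `η = 2Δ - 1`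
exists, so `Δ ≤ 3/4` by Duminil-Copin–Panis Thm 1.5 (tree theorem `dcp_isingEta_le_half_holds`); below
`3/4` the current branch concludes; AT `3/4` the limit is normalised (item 4739) and the marginal
exclusion concludes for `S'`, hence for `S`. -/
theorem crux_of_statements :
    Lamperti → EtaExists →
    Summit.CriticalPhenomena.Ising3DConformalLimit.Theses.WeylWindow.LimitNormalisation →
    CurrentBranch → MarginalExclusion → Crux := by
  intro hL hE hN hC hM ρ S hρ hlim hnd
  obtain ⟨Δ, h12, -, hidx, hcov⟩ := hL ρ S hρ hlim hnd
  have hWI : IsLimitWithIndex ρ S Δ := ⟨hρ, hlim, hnd, hidx⟩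
  have hη : HasIsingExponentEta 3 (2 * Δ - 1) := hE ρ S Δ hWI
  have h34 : Δ ≤ 3/4 := by
    have := dcp_isingEta_le_half_holds (2 * Δ - 1) hη
    linarith
  rcases lt_or_eq_of_le h34 with hlt | heq
  · exact hC ρ S Δ hWI hcov h12 hlt
  · subst heq
    obtain ⟨S', hWI', heqOn, hzero, hTI, hsc, hcont⟩ := normalise hN hWI hcov
    exact (hasNontrivialU4_iff_of_eqOn heqOn).1 (hM ρ S' hWI' hzero hTI hsc hcont)

/-- **REGISTERED COMPOSITION — the line closes the crux.** Its only hypothesis is the registered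
obligation `WeylWindow.LimitNormalisation` (item stmt-CriticalPhenomena-4739, by name); the four declared
stubs are applied inside; the conclusion is the crux decl BY NAME. -/
theorem IsingEuclidUpgradeR4NonGaussian_of
    (hN : Summit.CriticalPhenomena.Ising3DConformalLimit.Theses.WeylWindow.LimitNormalisation) :
    Summit.CriticalPhenomena.Ising3DConformalLimit.Theses.HyperoctahedralRP.IsingEuclidUpgradeR4NonGaussian :=
  crux_of_statements stub_lamperti stub_etaExists hN currentBranch_of_stubs stub_marginalExclusion

/-- **REGISTERED COMPOSITION, item-route copy**: the same composition concluding the item's own route decl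
`IsingEuclidUpgrade.IsingEuclidUpgradeR4NonGaussian` (the copies are one `Prop`, `crux_iff_isingEuclidUpgrade`). -/
theorem IsingEuclidUpgradeR4NonGaussian_of_isingEuclidUpgrade
    (hN : Summit.CriticalPhenomena.Ising3DConformalLimit.Theses.WeylWindow.LimitNormalisation) :
    Summit.CriticalPhenomena.Ising3DConformalLimit.Theses.IsingEuclidUpgrade.IsingEuclidUpgradeR4NonGaussian :=
  IsingEuclidUpgradeR4NonGaussian_of hN

/-! ### §5. Calibration (sorry-free): the branch stubs are WEAKENINGS of the crux, the marginal stub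
follows from either of two existing items, and the card's original `Δ = 1/2 ∨ Δ > 1/2` split also
closes the crux. -/

/-- The three branch statements are consequences of the crux (no stub is stronger than the crux). -/
theorem branches_of_crux (h : Crux) : CurrentBranch ∧ MarginalExclusion ∧ MeanFieldBranch :=
  ⟨fun ρ S _ hWI _ _ _ => h ρ S hWI.1 hWI.2.1 hWI.2.2.1,
    fun ρ S hWI _ _ _ _ => h ρ S hWI.1 hWI.2.1 hWI.2.2.1,
    fun ρ S hWI _ => h ρ S hWI.1 hWI.2.1 hWI.2.2.1⟩

/-- **(a)** item stmt-2601 closes the marginal branch: a Gaussian limit has `Δ = 1/2 ≠ 3/4`. -/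
theorem marginalExclusion_of_gaussianLimitIsFree
    (hGF : Summit.CriticalPhenomena.Ising3DConformalLimit.Theses.AnomalousForcesInteraction.GaussianLimitIsFree) :
    MarginalExclusion := by
  intro ρ S hWI _ hTI hsc _
  by_contra hU
  have h := hGF ρ (3/4) S hWI.1 hWI.2.1 hWI.2.2.1 hTI hsc hU
  norm_num at h

/-- **The card's original dispatch** (`Δ = 1/2` mean-field branch ∨ `Δ > 1/2` anomalous branch, the
latter = item 2601 fed through item 4739): also a complete cover, WITHOUT `EtaExists`. -/
theorem of_meanFieldBranch :
    Lamperti →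
    Summit.CriticalPhenomena.Ising3DConformalLimit.Theses.WeylWindow.LimitNormalisation →
    MeanFieldBranch →
    Summit.CriticalPhenomena.Ising3DConformalLimit.Theses.AnomalousForcesInteraction.GaussianLimitIsFree →
    Crux := by
  intro hL hN hMF hGF ρ S hρ hlim hnd
  obtain ⟨Δ, h12, -, hidx, hcov⟩ := hL ρ S hρ hlim hnd
  have hWI : IsLimitWithIndex ρ S Δ := ⟨hρ, hlim, hnd, hidx⟩
  rcases eq_or_lt_of_le h12 with heq | hgt
  · subst heq
    exact hMF ρ S hWI hcov
  · by_contra hU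
    obtain ⟨S', hWI', heqOn, -, hTI, hsc, -⟩ := normalise hN hWI hcov
    have hU' : ¬ HasNontrivialU4 S' := fun h => hU ((hasNontrivialU4_iff_of_eqOn heqOn).1 h)
    have h := hGF ρ Δ S' hWI'.1 hWI'.2.1 hWI'.2.2.1 hTI hsc hU'
    linarith

/-! ### §5b. Item stmt-5507 (`WindowBelowHalf`, `η_eff < 1/2` between axis scales) also closes the
marginal branch: it is INCONSISTENT with a limit of dimension `3/4`, so `MarginalExclusion` holds
vacuously under it. -/

/-- The reference pair `(0, e₀)`. -/
def refPair : Fin 2 → EuclideanSpace ℝ (Fin 3) := ![0, EuclideanSpace.single (0 : Fin 3) (1:ℝ)]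

theorem refPair_mem : refPair ∈ NonCoincident 3 2 := by
  refine pair_mem_nonCoincident fun h => ?_
  have := congrArg (fun v : EuclideanSpace ℝ (Fin 3) => v 0) h
  simp at this

/-- At mesh `1/m` the scaled reference pair `k•(0,e₀)` sits exactly on the lattice points
`(0, (k m)·e₁)`. -/
theorem latticeApprox_smul_refPair (k m : ℕ) (hm : 0 < m) :
    (fun i => latticeApprox (1 / (m:ℝ)) ((k:ℝ) • refPair i)) =
      ![(0 : Site 3), Pi.single 0 ((k * m : ℕ) : ℤ)] := by
  have hm' : (0:ℝ) < m := by exact_mod_cast hm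
  funext i j
  fin_cases i
  · simp [refPair, latticeApprox_apply]
  · simp only [refPair, latticeApprox_apply, Fin.mk_one, Matrix.cons_val_one, Matrix.cons_val_zero,
      PiLp.smul_apply, PiLp.single_apply, smul_eq_mul, Pi.single_apply]
    by_cases hj : j = 0
    · subst hj
      simp only [if_true, mul_one]
      rw [show (k:ℝ) / (1 / (m:ℝ)) = ((k * m : ℕ) : ℤ) by push_cast; field_simp]
      exact Int.floor_intCast _
    · simp [hj]

/-- **(b)** item stmt-5507 closes the marginal branch (vacuously: the window below `1/2` forbids a
limit of dimension `3/4`). With `a := S₂(0,e₀) > 0`, the convergence at the pairs `k•(0,e₀)` along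
the meshes `1/m` reads `ρ(1/m)²⟨σ₀σ_{kme₁}⟩ → k^{-3/2} a` (scale covariance), while `WindowBelowHalf`
gives `c·k^{-(3/2-ε)}·ρ(1/m)²⟨σ₀σ_{me₁}⟩ ≤ ρ(1/m)²⟨σ₀σ_{kme₁}⟩`; in the limit `c k^{ε} ≤ 1` for every
`k ≥ 1`, absurd for `k` large. -/
theorem marginalExclusion_of_windowBelowHalf
    (hW : Summit.CriticalPhenomena.Ising3DConformalLimit.Theses.LatticeSDPCertificates.WindowBelowHalf) :
    MarginalExclusion := by
  intro ρ S hWI _ _ hsc _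
  obtain ⟨hρ, hlim, hnd, -⟩ := hWI
  obtain ⟨ε, c, hε, hc, hwin⟩ := hW
  exfalso
  set a : ℝ := S 2 refPair with ha_def
  have ha : 0 < a := hnd _ refPair_mem
  -- the mesh sequence `δ_m = 1/m → 0⁺`
  have hδ : Tendsto (fun m : ℕ => (1:ℝ) / m) atTop (𝓝[>] (0:ℝ)) := by
    refine tendsto_nhdsWithin_iff.2 ⟨tendsto_one_div_atTop_nhds_zero_nat, ?_⟩
    filter_upwards [eventually_ge_atTop 1] with m hm
    have hm' : (0:ℝ) < m := Nat.cast_pos.2 hm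
    exact one_div_pos.2 hm'
  -- `T_k(m) := ρ(1/m)² ⟨σ₀σ_{kme₁}⟩ → k^{-2·(3/4)} a`
  have hT : ∀ k : ℕ, 0 < k →
      Tendsto (fun m : ℕ => ρ (1 / m) ^ 2 * criticalTwoPoint 3 (Pi.single 0 ((k * m : ℕ) : ℤ)))
        atTop (𝓝 ((k:ℝ) ^ (-((2:ℕ):ℝ) * (3/4)) * a)) := by
    intro k hk
    have hk' : (0:ℝ) < k := by exact_mod_cast hk
    have hmem : (fun i => (k:ℝ) • refPair i) ∈ NonCoincident 3 2 :=
      smul_mem_nonCoincident hk'.ne' refPair_mem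
    have h1 := ((hlim 2).tendsto_at hmem).comp hδ
    rw [hsc 2 k hk' refPair] at h1
    refine h1.congr' ?_
    filter_upwards [eventually_ge_atTop 1] with m hm
    simp only [Function.comp_apply, rescaledCorrelator_apply]
    rw [latticeApprox_smul_refPair k m hm, criticalCorr_two]
  -- the window inequality, multiplied by `ρ(1/m)²`
  have key : ∀ k : ℕ, 0 < k → c * (k:ℝ) ^ (-((3:ℝ) / 2 - ε)) * a ≤ (k:ℝ) ^ (-((2:ℕ):ℝ) * (3/4)) * a := by
    intro k hk
    have hk' : (0:ℝ) < k := by exact_mod_cast hk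
    have hlhs : Tendsto (fun m : ℕ => c * (k:ℝ) ^ (-((3:ℝ) / 2 - ε)) *
        (ρ (1 / m) ^ 2 * criticalTwoPoint 3 (Pi.single 0 (m : ℤ)))) atTop
        (𝓝 (c * (k:ℝ) ^ (-((3:ℝ) / 2 - ε)) * a)) := by
      have h := (hT 1 one_pos).const_mul (c * (k:ℝ) ^ (-((3:ℝ) / 2 - ε)))
      simp only [Nat.cast_one, Real.one_rpow, one_mul] at h
      exact h
    refine le_of_tendsto_of_tendsto hlhs (hT k hk) ?_
    filter_upwards [eventually_ge_atTop 1] with m hm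
    have hmR : (0:ℝ) < m := by exact_mod_cast hm
    have hw := hwin m (k * m) hm (Nat.le_mul_of_pos_left m hk)
    have hratio : ((k * m : ℕ) : ℝ) / m = k := by push_cast; field_simp
    rw [hratio] at hw
    have hρ2 : 0 ≤ ρ (1 / m) ^ 2 := sq_nonneg _
    have := mul_le_mul_of_nonneg_left hw hρ2
    calc c * (k:ℝ) ^ (-((3:ℝ) / 2 - ε)) * (ρ (1 / ↑m) ^ 2 * criticalTwoPoint 3 (Pi.single 0 (m:ℤ)))
        = ρ (1 / ↑m) ^ 2 * (c * (k:ℝ) ^ (-((3:ℝ) / 2 - ε)) * criticalTwoPoint 3 (Pi.single 0 (m:ℤ))) := by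
          ring
      _ ≤ ρ (1 / ↑m) ^ 2 * criticalTwoPoint 3 (Pi.single 0 ((k * m : ℕ) : ℤ)) := this
  -- `c k^ε ≤ 1` for all `k ≥ 1`
  have key' : ∀ k : ℕ, 0 < k → c * (k:ℝ) ^ ε ≤ 1 := by
    intro k hk
    have hk' : (0:ℝ) < k := by exact_mod_cast hk
    have h := key k hk
    have hexp : (k:ℝ) ^ (-((2:ℕ):ℝ) * (3/4)) = (k:ℝ) ^ (-((3:ℝ) / 2)) := by norm_num
    have hsplit : (k:ℝ) ^ (-((3:ℝ) / 2 - ε)) = (k:ℝ) ^ (-((3:ℝ) / 2)) * (k:ℝ) ^ ε := by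
      rw [← Real.rpow_add hk']; congr 1; ring
    rw [hexp, hsplit] at h
    have hpos : 0 < (k:ℝ) ^ (-((3:ℝ) / 2)) * a := mul_pos (Real.rpow_pos_of_pos hk' _) ha
    have h' : (c * (k:ℝ) ^ ε) * ((k:ℝ) ^ (-((3:ℝ) / 2)) * a) ≤ 1 * ((k:ℝ) ^ (-((3:ℝ) / 2)) * a) := by
      calc (c * (k:ℝ) ^ ε) * ((k:ℝ) ^ (-((3:ℝ) / 2)) * a)
          = c * ((k:ℝ) ^ (-((3:ℝ) / 2)) * (k:ℝ) ^ ε) * a := by ring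
        _ ≤ (k:ℝ) ^ (-((3:ℝ) / 2)) * a := h
        _ = 1 * ((k:ℝ) ^ (-((3:ℝ) / 2)) * a) := by ring
    exact le_of_mul_le_mul_right h' hpos
  -- choose `k` with `k^ε ≥ 2/c`
  set K : ℝ := (2 / c) ^ (1 / ε) with hK
  have hK0 : 0 ≤ K := Real.rpow_nonneg (by positivity) _
  set k : ℕ := ⌈K⌉₊ + 1 with hk_def
  have hk : 0 < k := Nat.succ_pos _
  have hKk : K ≤ k := by
    have : K ≤ ⌈K⌉₊ := Nat.le_ceil K
    have h2 : (⌈K⌉₊ : ℝ) ≤ k := by rw [hk_def]; push_cast; linarith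
    exact this.trans h2
  have hKε : K ^ ε = 2 / c := by
    rw [hK, ← Real.rpow_mul (by positivity)]
    rw [show (1 / ε) * ε = 1 by field_simp, Real.rpow_one]
  have hge : 2 / c ≤ (k:ℝ) ^ ε := hKε ▸ Real.rpow_le_rpow hK0 hKk hε.le
  have h2 : 2 ≤ c * (k:ℝ) ^ ε := by
    have := mul_le_mul_of_nonneg_left hge hc.le
    rwa [mul_div_cancel₀ _ hc.ne'] at this
  linarith [key' k hk]

end Summit.CriticalPhenomena.Ising3DConformalLimit.Cruxes.IsingEuclidUpgradeR4NonGaussian.FreeCovarianceDeltaDichotomy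

end
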